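import Mathlib.RingTheory.MvPolynomial.Symmetric.NewtonIdentities
import Mathlib.Analysis.Complex.Trigonometric
import HarnessLib

/-!
# Route LittlewoodRadar · crux `PintzLocalisationPos` (stmt-RiemannHypothesis-23714) · LINE `pintz-kernel` · stub `stub_cassels`

The registered stub `stub_cassels` of the skeleton `Lines/pintz-kernel.lean` (route lead
rlead-rh-LittlewoodRadar g0) — the **modified Cassels power-sum lemma** in the weighted real form the line
uses: for finitely many complex "exponents" `z_i` with multiplicities `w_i ∈ ℕ`, `W = Σ w_i`, and any `H > 0`,
some `L ∈ [H, (2W+1)H]` has `Σ_i w_i e^{L Re z_i} cos (L Im z_i) ≥ 0`.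

Proof (Cassels 1956 via Newton's identities; no literature fact needed): take `L = ν H`, `ν ∈ {1,…,2W+1}`.
With `u_i = e^{H z_i}` listed `w_i` times together with their conjugates (a family of `2W` complex numbers
`x`), `Σ_i w_i e^{νH Re z_i} cos(νH Im z_i) = ½ p_ν(x)` where `p_ν` is the `ν`-th power sum.  If
`p_1, …, p_{2W+1}` were all negative reals, Newton's identities `k e_k = Σ_{a<k} (−1)^{a} … ` (Mathlib's
`MvPolynomial.mul_esymm_eq_sum`, evaluated at `x`) would make `(−1)^k e_k(x)` a positive real for every
`k ≤ 2W` by induction, and then the identity at `k = 2W+1` (where `e_{2W+1} = 0`) reads `0 = Σ (positive)`,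
absurd (Cassels 1956; the weighted real-parameter form is Révész's "modified Cassels lemma",
arXiv:2202.01837 Lemma 3, whose proof — Révész, Acta Arith. 49 (1988) — is not held; this file needs neither).

Rung currency for the RH-free door `ThetaRadarDoor`; nothing here bears on the truth of RH.
-/

-- D-0017: `Summit.RiemannHypothesis.RiemannHypothesis.…` duplicates the namespace BY DESIGN (single-problem summit).
set_option linter.dupNamespace false

noncomputable section

namespace Summit.RiemannHypothesis.RiemannHypothesis.Theorems.LittlewoodRadar

open scoped ComplexConjugate
open Finset

/-- **Cassels' sign lemma.** The power sums `p_n = Σ_s (x s)^n`, `1 ≤ n ≤ #σ + 1`, of a finite family of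
complex numbers are not all negative reals. (Newton's identities.) [cite: Cassels1956, Theorem] -/
theorem not_all_powerSums_neg {σ : Type} [Fintype σ] [DecidableEq σ] (x : σ → ℂ) (q : ℕ → ℝ)
    (hq : ∀ n, 1 ≤ n → n ≤ Fintype.card σ + 1 → q n < 0)
    (hP : ∀ n, 1 ≤ n → n ≤ Fintype.card σ + 1 → ∑ s, x s ^ n = (q n : ℂ)) : False := by
  classical
  set N := Fintype.card σ with hN
  -- evaluated elementary symmetric functions and Newton's identities
  set e : ℕ → ℂ := fun n => MvPolynomial.eval x (MvPolynomial.esymm σ ℂ n) with he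
  have hpsum : ∀ n, MvPolynomial.eval x (MvPolynomial.psum σ ℂ n) = ∑ s, x s ^ n := by
    intro n; simp [MvPolynomial.psum, map_sum, map_pow, MvPolynomial.eval_X]
  have newton : ∀ k : ℕ, (k : ℂ) * e k = (-1) ^ (k + 1) *
      ∑ a ∈ (antidiagonal k).filter (fun a => a.1 < k), (-1) ^ a.1 * e a.1 * ∑ s, x s ^ a.2 := by
    intro k
    have h := congrArg (MvPolynomial.eval x) (MvPolynomial.mul_esymm_eq_sum σ ℂ k)
    simp only [map_mul, map_natCast, map_pow, map_neg, map_one, map_sum, hpsum] at h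
    exact h
  -- the signed coefficients `c k = (-1)^k e_k`
  set c : ℕ → ℂ := fun k => (-1) ^ k * e k with hc
  -- key identity: `k c_k = Σ_{a+b=k, a<k} c_a (−q_b)` for `1 ≤ k ≤ N+1`
  have key : ∀ k : ℕ, 1 ≤ k → k ≤ N + 1 →
      (k : ℂ) * c k = ∑ a ∈ (antidiagonal k).filter (fun a => a.1 < k), c a.1 * ((-q a.2 : ℝ) : ℂ) := by
    intro k hk1 hk2
    have hsign : (-1 : ℂ) ^ k * (-1) ^ (k + 1) = -1 := by
      rw [← pow_add]; exact Odd.neg_one_pow ⟨k, by ring⟩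
    calc (k : ℂ) * c k = (-1) ^ k * ((k : ℂ) * e k) := by simp only [hc]; ring
      _ = -1 * ∑ a ∈ (antidiagonal k).filter (fun a => a.1 < k), (-1) ^ a.1 * e a.1 * ∑ s, x s ^ a.2 := by
          rw [newton k, ← mul_assoc, hsign]
      _ = ∑ a ∈ (antidiagonal k).filter (fun a => a.1 < k), c a.1 * ((-q a.2 : ℝ) : ℂ) := by
          rw [neg_one_mul, ← sum_neg_distrib]
          refine sum_congr rfl fun a ha => ?_
          rw [mem_filter, mem_antidiagonal] at ha
          have hb1 : 1 ≤ a.2 := by omega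
          have hb2 : a.2 ≤ N + 1 := by omega
          rw [hP a.2 hb1 hb2]
          simp only [hc]; push_cast; ring
  -- one induction step, shared by the induction and the final contradiction
  have step : ∀ k : ℕ, 1 ≤ k → k ≤ N + 1 → (∀ a, a < k → (c a).im = 0 ∧ 0 < (c a).re) →
      (c k).im = 0 ∧ 0 < (k : ℝ) * (c k).re := by
    intro k hk1 hk2 ih
    have hk := key k hk1 hk2
    have hkR : (k : ℂ) * c k = ((k : ℝ) : ℂ) * c k := by push_cast; ring
    rw [hkR] at hk
    have him := congrArg Complex.im hk
    have hre := congrArg Complex.re hk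
    rw [Complex.im_ofReal_mul, Complex.im_sum] at him
    rw [Complex.re_ofReal_mul, Complex.re_sum] at hre
    have him0 : ∑ a ∈ (antidiagonal k).filter (fun a => a.1 < k), (c a.1 * ((-q a.2 : ℝ) : ℂ)).im = 0 := by
      refine sum_eq_zero fun a ha => ?_
      rw [mem_filter] at ha
      rw [Complex.im_mul_ofReal, (ih a.1 ha.2).1, zero_mul]
    have hre0 : 0 < ∑ a ∈ (antidiagonal k).filter (fun a => a.1 < k), (c a.1 * ((-q a.2 : ℝ) : ℂ)).re := by
      refine sum_pos (fun a ha => ?_) ⟨(0, k), by simp [mem_filter, mem_antidiagonal]; omega⟩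
      rw [mem_filter, mem_antidiagonal] at ha
      rw [Complex.re_mul_ofReal]
      have hb1 : 1 ≤ a.2 := by omega
      have hb2 : a.2 ≤ N + 1 := by omega
      have hqneg := hq a.2 hb1 hb2
      exact mul_pos (ih a.1 ha.2).2 (by linarith)
    have hkpos : (0 : ℝ) < k := by exact_mod_cast hk1
    refine ⟨?_, by linarith⟩
    rw [him0] at him
    rcases mul_eq_zero.1 him with h | h
    · exact absurd h hkpos.ne'
    · exact h
  -- induction: `c k` is a positive real for `k ≤ N`
  have claim : ∀ k : ℕ, k ≤ N → (c k).im = 0 ∧ 0 < (c k).re := by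
    intro k
    induction k using Nat.strong_induction_on with
    | _ k ih =>
      intro hk
      rcases Nat.eq_zero_or_pos k with rfl | hkpos
      · simp [hc, he, MvPolynomial.esymm_zero]
      · have hkR : (0 : ℝ) < k := by exact_mod_cast hkpos
        obtain ⟨h1, h2⟩ := step k hkpos (by omega) fun a ha => ih a ha (by omega)
        exact ⟨h1, pos_of_mul_pos_right (by nlinarith [h2]) hkR.le⟩
  -- the identity at `k = N+1`, where `e_{N+1} = 0`
  have hz : e (N + 1) = 0 := by
    simp only [he, MvPolynomial.esymm]
    rw [powersetCard_eq_empty.2 (by simp [hN]), sum_empty, map_zero]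
  have hcz : c (N + 1) = 0 := by simp only [hc, hz, mul_zero]
  obtain ⟨-, h2⟩ := step (N + 1) (by omega) le_rfl fun a ha => claim a (by omega)
  rw [hcz, Complex.zero_re, mul_zero] at h2
  exact lt_irrefl _ h2

/-- **Registered stub `stub_cassels` of LINE `pintz-kernel`** (crux `PintzLocalisationPos`,
stmt-RiemannHypothesis-23714): the weighted real form of the modified Cassels power-sum lemma — for
`H > 0` some `L ∈ [H, (2 Σ w + 1) H]` makes `Σ_i w_i e^{L Re z_i} cos (L Im z_i) ≥ 0` (take `L = ν H`,
`1 ≤ ν ≤ 2 Σ w + 1`, by `not_all_powerSums_neg` applied to the `e^{H z_i}` with multiplicity and their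
conjugates); Révész arXiv:2202.01837 Lemma 3 in weighted form. [cite: Cassels1956, Theorem] -/
theorem stub_cassels :
    ∀ {ι : Type} (t : Finset ι) (z : ι → ℂ) (w : ι → ℕ) (H : ℝ), 0 < H →
      ∃ L : ℝ, H ≤ L ∧ L ≤ (2 * (∑ i ∈ t, (w i : ℝ)) + 1) * H ∧
        0 ≤ ∑ i ∈ t, (w i : ℝ) * (Real.exp (L * (z i).re) * Real.cos (L * (z i).im)) := by
  intro ι t z w H hH
  classical
  by_contra hneg
  push Not at hneg
  -- the family: `e^{H z_i}` repeated `w i` times, and its conjugates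
  let σ := ((i : t) × Fin (w i)) × Bool
  let x : σ → ℂ := fun s =>
    cond s.2 (Complex.exp (H * z s.1.1)) (conj (Complex.exp (H * z s.1.1)))
  have hcard : Fintype.card σ = 2 * ∑ i ∈ t, w i := by
    simp only [σ, Fintype.card_prod, Fintype.card_bool, Fintype.card_sigma, Fintype.card_fin]
    rw [Finset.sum_coe_sort t w]; ring
  let f : ℝ → ℝ := fun L => ∑ i ∈ t, (w i : ℝ) * (Real.exp (L * (z i).re) * Real.cos (L * (z i).im))
  -- power sums of the family are `2 f(νH)`
  have hpow : ∀ n : ℕ, ∑ s, x s ^ n = ((2 * f (n * H) : ℝ) : ℂ) := by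
    intro n
    have hterm : ∀ i : t, Complex.exp (H * z i) ^ n + conj (Complex.exp (H * z i)) ^ n =
        ((2 * (Real.exp (n * H * (z i).re) * Real.cos (n * H * (z i).im)) : ℝ) : ℂ) := by
      intro i
      rw [← map_pow, Complex.add_conj, ← Complex.exp_nat_mul, Complex.exp_re]
      congr 4
      · rw [show (n : ℂ) * ((H : ℂ) * z i) = (((n : ℝ) * H : ℝ) : ℂ) * z i by push_cast; ring,
          Complex.re_ofReal_mul]
      · rw [show (n : ℂ) * ((H : ℂ) * z i) = (((n : ℝ) * H : ℝ) : ℂ) * z i by push_cast; ring,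
          Complex.im_ofReal_mul]
    rw [Fintype.sum_prod_type]
    simp only [Fintype.sum_bool, x, cond_true, cond_false]
    rw [Fintype.sum_sigma]
    simp only [hterm, sum_const, card_univ, Fintype.card_fin, nsmul_eq_mul]
    rw [Finset.sum_coe_sort t (fun i => (w i : ℂ) *
      (((2 * (Real.exp (n * H * (z i).re) * Real.cos (n * H * (z i).im)) : ℝ) : ℂ)))]
    simp only [f, mul_sum]
    push_cast
    exact sum_congr rfl fun i _ => by ring
  refine not_all_powerSums_neg x (fun n => 2 * f (n * H)) (fun n h1 h2 => ?_) (fun n _ _ => hpow n)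
  have hn1 : (1 : ℝ) ≤ n := by exact_mod_cast h1
  have hn2 : (n : ℝ) ≤ 2 * (∑ i ∈ t, (w i : ℝ)) + 1 := by
    have : (n : ℝ) ≤ (Fintype.card σ : ℝ) + 1 := by exact_mod_cast h2
    rw [hcard] at this; push_cast at this; linarith
  have hlt := hneg (n * H) (by nlinarith) (by nlinarith)
  show 2 * f (n * H) < 0
  simp only [f]; linarith

end Summit.RiemannHypothesis.RiemannHypothesis.Theorems.LittlewoodRadar

end
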